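import Literature.Analysis.PDE.FreeFlowSlabSmooth
import Literature.Analysis.PDE.SobolevTransport
import Mathlib.LinearAlgebra.Matrix.AbsoluteValue
import Mathlib.Analysis.Calculus.ContDiff.Bounds
import HarnessLib

/-!
# Word-derivative bounds under affine maps and products; a determinant bound
# (topic `Analysis/PDE`)

Generic analysis infrastructure for discharging the uniform coefficient / cut-off bounds of the
flat fine parametrix (layer (I') of the programme to prove short-time existence for quasilinear
strictly parabolic systems on a closed manifold, hypothesis `hQL` of
`Literature.Geometry.Riemannian.ricciFlow_shortTime_existence_of_quasilinear`). The energy lemmas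
of that programme consume bounds of FRAME WORD derivatives `‖∂_{b_{i₁}} ⋯ ∂_{b_{iₘ}} f (z)‖`
(`iterDirDeriv`); this file relates them to the full iterated derivative and controls them under
the operations used to build the adapted coefficient fields:

* `norm_iterDirDeriv_le_pow` — words with directions of norm `≤ c` are bounded by `c^m ‖Dᵐf‖`;
* `iterDirDeriv_comp_affine` — `∂_β (f ∘ Ψ) = (∂_{Bβ} f) ∘ Ψ` for `Ψ z = B z + c`;
  `norm_iterDirDeriv_frame_comp_affine_le` — frame words of `f ∘ Ψ` are bounded by `‖B‖ᵐ ‖Dᵐf‖`;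
* `norm_iteratedFDeriv_le_of_frame_words` — conversely `‖Dᵐ f(z)‖ ≤ nᵐ · max_{frame words}`;
* `norm_iteratedFDeriv_smul_le_of_bounds` — products: `‖Dᵐ(φ • G)‖ ≤ 2ᵐ Mφ M_G`;
* `abs_det_le_factorial_mul_norm_pow` — `|det M| ≤ n! ‖M‖ⁿ` (Hadamard's weak bound via the
  matrix in the standard frame).

Everything is proved; no named fact and no `sorry` is introduced.

## References

* L. Hörmander, *The Analysis of Linear Partial Differential Operators I*, Springer 1983,
  §1.1 (Leibniz and chain rules for higher derivatives). [folklore]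
-/

noncomputable section

open Set Function Filter Topology Metric InnerProductSpace
open scoped ContDiff Topology RealInnerProductSpace

namespace Literature.Analysis.PDE

open Literature.Analysis.FunctionSpaces

variable {E' : Type*} [NormedAddCommGroup E'] [InnerProductSpace ℝ E'] [FiniteDimensional ℝ E']
variable {F : Type*} [NormedAddCommGroup F] [NormedSpace ℝ F]

/-! ### Words versus the full iterated derivative -/

omit [FiniteDimensional ℝ E'] in
/-- **Words with directions of norm at most `c`**: `‖∂_β f(z)‖ ≤ c^{|β|} ‖D^{|β|} f(z)‖` for smooth
`f`. [folklore] -/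
theorem norm_iterDirDeriv_le_pow {f : E' → F} (hf : ContDiff ℝ ∞ f) (β : List E') {c : ℝ}
    (hβ : ∀ v ∈ β, ‖v‖ ≤ c) (z : E') :
    ‖iterDirDeriv β f z‖ ≤ c ^ β.length * ‖iteratedFDeriv ℝ β.length f z‖ := by
  refine (norm_iterDirDeriv_le hf β z).trans ?_
  rw [mul_comm]
  refine mul_le_mul_of_nonneg_right ?_ (norm_nonneg _)
  calc ∏ i : Fin β.length, ‖β.get i‖ ≤ ∏ _i : Fin β.length, c :=
        Finset.prod_le_prod (fun i _ ↦ norm_nonneg _) fun i _ ↦ hβ _ (List.get_mem β i)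
    _ = c ^ β.length := by simp

/-- **Frame words are bounded by the full derivative**: `‖∂_{b_{i₁}}⋯∂_{b_{iₘ}} f(z)‖ ≤ ‖Dᵐf(z)‖`.
[folklore] -/
theorem norm_iterDirDeriv_frame_le {f : E' → F} (hf : ContDiff ℝ ∞ f) (lst : List (Fin (Module.finrank ℝ E')))
    (z : E') :
    ‖iterDirDeriv (lst.map (stdOrthonormalBasis ℝ E')) f z‖ ≤ ‖iteratedFDeriv ℝ lst.length f z‖ := by
  have h := norm_iterDirDeriv_le_pow hf (lst.map (stdOrthonormalBasis ℝ E')) (c := 1)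
    (fun v hv ↦ by
      obtain ⟨i, -, rfl⟩ := List.mem_map.1 hv
      rw [(stdOrthonormalBasis ℝ E').orthonormal.1 i]) z
  rw [List.length_map] at h
  simpa using h

/-! ### Composition with affine maps -/

omit [InnerProductSpace ℝ E'] [FiniteDimensional ℝ E'] in
/-- Chain rule for one direction under an affine map. [folklore] -/
theorem fderiv_comp_affine_apply' [NormedSpace ℝ E'] (B : E' →L[ℝ] E') (c : E') {g : E' → F}
    (hg : Differentiable ℝ g) (z v : E') :
    fderiv ℝ (fun z ↦ g (B z + c)) z v = fderiv ℝ g (B z + c) (B v) := by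
  have h1 : HasFDerivAt (fun z ↦ B z + c) B z := (B.hasFDerivAt).add_const c
  have h2 : HasFDerivAt g (fderiv ℝ g (B z + c)) (B z + c) := (hg _).hasFDerivAt
  have h := h2.comp z h1
  rw [show (fun z ↦ g (B z + c)) = g ∘ fun z ↦ B z + c from rfl, h.fderiv]
  rfl

omit [InnerProductSpace ℝ E'] [FiniteDimensional ℝ E'] in
/-- **Words under an affine change of variables**: `∂_β (f ∘ Ψ) = (∂_{Bβ} f) ∘ Ψ` for
`Ψ z = B z + c` and smooth `f`. [folklore] -/
theorem iterDirDeriv_comp_affine [NormedSpace ℝ E'] (B : E' →L[ℝ] E') (c : E') {f : E' → F} (hf : ContDiff ℝ ∞ f) :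
    ∀ β : List E', iterDirDeriv β (fun z ↦ f (B z + c)) = fun z ↦ iterDirDeriv (β.map B) f (B z + c)
  | [] => rfl
  | v :: β => by
    rw [iterDirDeriv_cons, iterDirDeriv_comp_affine B c hf β, List.map_cons, iterDirDeriv_cons]
    funext z
    exact fderiv_comp_affine_apply' B c ((contDiff_iterDirDeriv hf _).differentiable (by simp)) z v

/-- **Frame words of `f ∘ Ψ` are bounded by `‖B‖ᵐ ‖Dᵐ f(Ψ z)‖`** (`Ψ z = B z + c`). [folklore] -/
theorem norm_iterDirDeriv_frame_comp_affine_le (B : E' →L[ℝ] E') (c : E') {f : E' → F} (hf : ContDiff ℝ ∞ f)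
    (lst : List (Fin (Module.finrank ℝ E'))) (z : E') :
    ‖iterDirDeriv (lst.map (stdOrthonormalBasis ℝ E')) (fun z ↦ f (B z + c)) z‖ ≤
      ‖B‖ ^ lst.length * ‖iteratedFDeriv ℝ lst.length f (B z + c)‖ := by
  rw [iterDirDeriv_comp_affine B c hf]
  simp only [List.map_map]
  have h := norm_iterDirDeriv_le_pow hf (lst.map (B ∘ stdOrthonormalBasis ℝ E')) (c := ‖B‖)
    (fun v hv ↦ by
      obtain ⟨i, -, rfl⟩ := List.mem_map.1 hv
      simp only [Function.comp_apply]
      refine (B.le_opNorm _).trans ?_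
      rw [(stdOrthonormalBasis ℝ E').orthonormal.1 i, mul_one]) (B z + c)
  rw [List.length_map] at h
  exact h

/-! ### The full derivative from frame words -/

/-- Every direction expands in the frame inside a multilinear map:
`D(w₁,…,wₘ) = Σ_{v} (Πₖ ⟪b_{vₖ}, wₖ⟫) D(b_{v₁},…,b_{vₘ})`. [folklore] -/
theorem multilinear_apply_eq_sum_frame {m : ℕ} (D : ContinuousMultilinearMap ℝ (fun _ : Fin m ↦ E') F)
    (w : Fin m → E') :
    D w = ∑ v : Fin m → Fin (Module.finrank ℝ E'),
      (∏ k, ⟪stdOrthonormalBasis ℝ E' (v k), w k⟫) • D (fun k ↦ stdOrthonormalBasis ℝ E' (v k)) := by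
  classical
  set b := stdOrthonormalBasis ℝ E'
  have hw : w = fun k ↦ ∑ j, ⟪b j, w k⟫ • b j := by
    funext k; exact (b.sum_repr' (w k)).symm
  conv_lhs => rw [hw]
  rw [D.map_sum (fun k j ↦ ⟪b j, w k⟫ • b j)]
  refine Finset.sum_congr rfl fun v _ ↦ ?_
  rw [D.map_smul_univ]

/-- **The full derivative is bounded by the frame words**: if all frame words of length `m` at `z`
are bounded by `Mw ≥ 0` then `‖Dᵐ f(z)‖ ≤ nᵐ Mw`. [folklore] -/
theorem norm_iteratedFDeriv_le_of_frame_words {f : E' → F} (hf : ContDiff ℝ ∞ f) (m : ℕ) (z : E') {Mw : ℝ}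
    (hMw : 0 ≤ Mw)
    (h : ∀ v : Fin m → Fin (Module.finrank ℝ E'),
      ‖iterDirDeriv (List.ofFn fun k ↦ stdOrthonormalBasis ℝ E' (v k)) f z‖ ≤ Mw) :
    ‖iteratedFDeriv ℝ m f z‖ ≤ (Module.finrank ℝ E' : ℝ) ^ m * Mw := by
  classical
  set b := stdOrthonormalBasis ℝ E'
  refine ContinuousMultilinearMap.opNorm_le_bound (by positivity) fun w ↦ ?_
  rw [multilinear_apply_eq_sum_frame]
  calc ‖∑ v : Fin m → Fin (Module.finrank ℝ E'), (∏ k, ⟪b (v k), w k⟫) • iteratedFDeriv ℝ m f z (fun k ↦ b (v k))‖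
      ≤ ∑ v : Fin m → Fin (Module.finrank ℝ E'), ‖(∏ k, ⟪b (v k), w k⟫) • iteratedFDeriv ℝ m f z (fun k ↦ b (v k))‖ :=
        norm_sum_le _ _
    _ ≤ ∑ _v : Fin m → Fin (Module.finrank ℝ E'), (∏ k, ‖w k‖) * Mw := by
        refine Finset.sum_le_sum fun v _ ↦ ?_
        rw [norm_smul, Real.norm_eq_abs, Finset.abs_prod]
        refine mul_le_mul (Finset.prod_le_prod (fun k _ ↦ abs_nonneg _) fun k _ ↦ ?_) ?_ (norm_nonneg _)
          (Finset.prod_nonneg fun k _ ↦ norm_nonneg _)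
        · refine (abs_real_inner_le_norm _ _).trans ?_
          rw [b.orthonormal.1, one_mul]
        · rw [iteratedFDeriv_apply_eq_iterDirDeriv_ofFn hf]
          exact h v
    _ = (Module.finrank ℝ E' : ℝ) ^ m * Mw * ∏ k, ‖w k‖ := by
        rw [Finset.sum_const, Finset.card_univ, Fintype.card_fun, Fintype.card_fin, Fintype.card_fin, nsmul_eq_mul]
        push_cast
        ring

/-! ### Products -/

omit [FiniteDimensional ℝ E'] in
/-- **Iterated derivatives of a product from uniform bounds of the factors**:
`‖Dᵐ(φ • G)(z)‖ ≤ 2ᵐ Mφ M_G` when `‖Dʲφ(z)‖ ≤ Mφ` and `‖DʲG(z)‖ ≤ M_G` for `j ≤ m`. [folklore] -/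
theorem norm_iteratedFDeriv_smul_le_of_bounds {φ : E' → ℝ} {G : E' → F} (hφ : ContDiff ℝ ∞ φ) (hG : ContDiff ℝ ∞ G)
    (m : ℕ) (z : E') {Mφ MG : ℝ} (hMφ0 : 0 ≤ Mφ) (hMφ : ∀ j ≤ m, ‖iteratedFDeriv ℝ j φ z‖ ≤ Mφ)
    (hMG : ∀ j ≤ m, ‖iteratedFDeriv ℝ j G z‖ ≤ MG) :
    ‖iteratedFDeriv ℝ m (fun y ↦ φ y • G y) z‖ ≤ 2 ^ m * Mφ * MG := by
  have hMG0 : 0 ≤ MG := (norm_nonneg _).trans (hMG 0 (Nat.zero_le _))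
  refine (norm_iteratedFDeriv_smul_le hφ hG z (n := m) (by exact_mod_cast le_top)).trans ?_
  calc ∑ i ∈ Finset.range (m + 1), (m.choose i : ℝ) * ‖iteratedFDeriv ℝ i φ z‖ * ‖iteratedFDeriv ℝ (m - i) G z‖
      ≤ ∑ i ∈ Finset.range (m + 1), (m.choose i : ℝ) * Mφ * MG := by
        refine Finset.sum_le_sum fun i hi ↦ ?_
        have hi' : i ≤ m := Nat.lt_succ_iff.1 (Finset.mem_range.1 hi)
        exact mul_le_mul (mul_le_mul_of_nonneg_left (hMφ i hi') (Nat.cast_nonneg _)) (hMG (m - i) (Nat.sub_le _ _))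
          (norm_nonneg _) (mul_nonneg (Nat.cast_nonneg _) hMφ0)
    _ = (∑ i ∈ Finset.range (m + 1), (m.choose i : ℝ)) * Mφ * MG := by
        rw [Finset.sum_mul, Finset.sum_mul]
    _ = 2 ^ m * Mφ * MG := by
        congr 2
        rw [← Nat.cast_sum, Nat.sum_range_choose]
        push_cast
        ring

/-- **Frame words of a product**, from uniform bounds of the iterated derivatives of the factors:
`‖∂_β(φ • G)(z)‖ ≤ 2^{|β|} Mφ M_G`. [folklore] -/
theorem norm_iterDirDeriv_frame_smul_le {φ : E' → ℝ} {G : E' → F} (hφ : ContDiff ℝ ∞ φ) (hG : ContDiff ℝ ∞ G)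
    (lst : List (Fin (Module.finrank ℝ E'))) (z : E') {Mφ MG : ℝ} (hMφ0 : 0 ≤ Mφ)
    (hMφ : ∀ j ≤ lst.length, ‖iteratedFDeriv ℝ j φ z‖ ≤ Mφ) (hMG : ∀ j ≤ lst.length, ‖iteratedFDeriv ℝ j G z‖ ≤ MG) :
    ‖iterDirDeriv (lst.map (stdOrthonormalBasis ℝ E')) (fun y ↦ φ y • G y) z‖ ≤ 2 ^ lst.length * Mφ * MG :=
  (norm_iterDirDeriv_frame_le (hφ.smul hG) lst z).trans (norm_iteratedFDeriv_smul_le_of_bounds hφ hG _ z hMφ0 hMφ hMG)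

/-! ### A determinant bound -/

/-- **Hadamard's weak bound**: `|det M| ≤ n! ‖M‖ⁿ` for a linear map of an `n`-dimensional inner
product space (entries of its matrix in the standard frame are bounded by `‖M‖`). [folklore] -/
theorem abs_det_le_factorial_mul_norm_pow (M : E' →L[ℝ] E') :
    |LinearMap.det (M : E' →ₗ[ℝ] E')| ≤
      (Module.finrank ℝ E').factorial * ‖M‖ ^ Module.finrank ℝ E' := by
  set b := stdOrthonormalBasis ℝ E'
  have hdet : LinearMap.det (M : E' →ₗ[ℝ] E') = (LinearMap.toMatrix b.toBasis b.toBasis (M : E' →ₗ[ℝ] E')).det :=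
    (LinearMap.det_toMatrix b.toBasis _).symm
  rw [hdet]
  have hentry : ∀ i j, |LinearMap.toMatrix b.toBasis b.toBasis (M : E' →ₗ[ℝ] E') i j| ≤ ‖M‖ := by
    intro i j
    rw [LinearMap.toMatrix_apply, b.coe_toBasis_repr_apply, b.repr_apply_apply, b.coe_toBasis]
    refine (abs_real_inner_le_norm _ _).trans ?_
    rw [b.orthonormal.1 i, one_mul]
    refine (M.le_opNorm _).trans ?_
    rw [b.orthonormal.1 j, mul_one]
  have h := Matrix.det_le (abv := AbsoluteValue.abs) hentry
  rw [Fintype.card_fin, nsmul_eq_mul] at h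
  exact h

end Literature.Analysis.PDE

end
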